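import Literature.NumberTheory.EllipticCurves.OggFormulaTwistTameIstarTwoProofs
import Literature.NumberTheory.EllipticCurves.NeronComponentIndexTypeIIIProofs
import Literature.NumberTheory.EllipticCurves.NeronComponentIndexTypeIIIstarProofs
import Literature.NumberTheory.EllipticCurves.NeronComponentIndexTypeI0starProofs
import Literature.NumberTheory.DiophantineGeometry.TateAlgorithmInvarianceProofs
import HarnessLib

/-!
# The values of `ord₂ Δ_min` on each Kodaira branch when `2` is a uniformiser (and over `ℚ`)

`Proofs` file (theorems only, no definitions, no named facts) in topics
`NumberTheory/DiophantineGeometry` (DVR level) and `NumberTheory/EllipticCurves` (over `ℚ`),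
landed by the seat of bsd.S15 (`Literature.NumberTheory.EllipticCurves.conductorNorm_eq_artinConductorNat`)
for the **final assembly of Ogg's formula at `2` over `ℚ`** (Silverman, *ATAEC* IV.11.1, `p = 2`,
PDF p. 366): the assembly is a case split on the Kodaira symbol `T` and on `n = ord₂ Δ_min`, and
needs, for each additive `T`, the exact finite set of values of `n` — the branches `(T, n)` —
together with the sub-branch conditions on Tate's normal forms that produce each value.

`ConductorExponentLeEightProofs` proved the bound `ord Δ ≤ m + 7` branch by branch and recorded the
exact values in its docstrings; this file exports them as theorems, with the same polynomial
identities `Δ = 2ⁿ(X + 2J)` (`X` a unit; found there by computer algebra and checked by `ring`):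

* Step 3 (type `II`; `a₁ = 2α`, `a₃ = 2γ`, `a₄ = 2q`, `a₆ = 2r`, `r ∈ Rˣ`):
  `n = 4` iff `γ ∈ Rˣ`; else `n = 6` iff `r + (α² + a₂)q ∈ Rˣ`, else `n = 7`
  (`addVal_Δ_toNat_of_step3`, `addVal_Δ_toNat_eq_of_step3 : n = 4 ∨ n = 6 ∨ n = 7`);
* Step 4 (type `III`; `a₆ = 4r₁`, `8 ∤ b₈`): `n = 4` iff `γ ∈ Rˣ`; else (`γ = 2γ₁`, `q ∈ Rˣ`)
  `n = 6` iff `α² + a₂ ∈ Rˣ`; else (`a₂ = 2β - α²`) `n = 8` iff `βq + γ₁² + r₁ ∈ Rˣ`, else `n = 9`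
  (`addVal_Δ_toNat_of_step4`, `… = 4 ∨ 6 ∨ 8 ∨ 9`);
* Step 6 (type `I₀*`; `(2α, 2p, 4γ, 4q, 8r)`, `pq + r ∈ Rˣ`): `n = 8` iff `α²q + γ² ∈ Rˣ`; else
  `n = 9` iff `α ∈ Rˣ`, else `n = 10` (`addVal_Δ_toNat_of_step6`, `… = 8 ∨ 9 ∨ 10`);
* Step 9 (type `III*`; `(2α, 4p, 8γ, 8q, 32r)`, `q ∈ Rˣ`): `n = 10` iff `α ∈ Rˣ`; else (`α = 2α₁`)
  `n = 12` iff `γ ∈ Rˣ`; else (`γ = 2γ₁`) `n = 14` iff `r + (α₁² + p)q ∈ Rˣ`, else `n = 15`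
  (`addVal_Δ_toNat_of_step9`, `… = 10 ∨ 12 ∨ 14 ∨ 15`);
* Step 10 (type `II*`; `(2α, 4p, 8γ, 16q, 32r)`, `r ∈ Rˣ`): `n = 11` iff `α ∈ Rˣ`; else `n = 12`
  iff `γ ∈ Rˣ`, else `n = 14` (`addVal_Δ_toNat_of_step10`, `… = 11 ∨ 12 ∨ 14`).

At the level of a minimal equation `V` over a DVR `R` in which `2` is a uniformiser, with perfect
residue field (`kodairaSymbolOfMinimal`, the tree's literal Tate's algorithm, and its normal forms
`exists_smul_of_kodairaSymbolOfMinimal_eq_III/_Istar_zero/_IIIstar/_IIstar`,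
`LocalIndex.exists_smul_a₁_eq_zero_of_kodairaSymbolOfMinimal_eq_II_of_two`):
`addVal_Δ_toNat_eq_of_kodairaSymbolOfMinimal_eq_II : n = 4 ∨ n = 6 ∨ n = 7`, `…_III : 4 ∨ 6 ∨ 8 ∨ 9`,
`…_Istar_zero : 8 ∨ 9 ∨ 10`, `…_IIIstar : 10 ∨ 12 ∨ 14 ∨ 15`, `…_IIstar : 11 ∨ 12 ∨ 14`; and over `ℚ`
at `v ∋ 2` the same for `W.ordMinimalDiscriminant v` given `W.kodairaSymbolAt v`
(`WeierstrassCurve.ordMinimalDiscriminant_eq_of_kodairaSymbolAt_II_two`, …).  Types `IV`, `IV*` have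
`n = 4`, `8` (`ordMinimalDiscriminant_eq_of_kodairaSymbolAt_IV_two/_IVstar_two`,
`OggFormulaTameTypesTwoProofs`); type `Iₙ*` (`n ≥ 1`) has `ord Δ - n ∈ {6, …, 11}` by
`ConductorExponentLeEightProofs` and `TateAlgorithmOggBound` and is not refined here.

These sets agree with the tables of I. Papadopoulos, *Sur la classification de Néron des courbes
elliptiques en caractéristique résiduelle 2 et 3*, J. Number Theory 44 (1993), 119–152 (case
`v(2) = 1`), cited for comparison only.

## References

* J. H. Silverman, *Advanced Topics in the Arithmetic of Elliptic Curves*, GTM 151 (1994), IV.9.4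
  (Tate's algorithm, Steps 3–10) and Table 4.1; IV.11.1 (Ogg's formula; `p = 2`, PDF p. 366).
  [SilvermanATAEC1994]
* I. Papadopoulos, *Sur la classification de Néron des courbes elliptiques en caractéristique
  résiduelle 2 et 3*, J. Number Theory 44 (1993), 119–152 (tables, `p = 2`; comparison only).

## Design

Theorems only.  §1 in namespace `Literature.NumberTheory.DiophantineGeometry.TateAlgorithm.CharTwo`
(the setting and helpers of `ConductorExponentLeEightProofs`: `2` irreducible in a DVR `R`), stated
with explicit witnesses `a₁ = 2α, …` so that the sub-branch conditions can be named; §2 the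
type-level corollaries for minimal equations (perfect residue field); §3 over `ℚ` in namespace
`WeierstrassCurve` (`kodairaSymbolAt_def`, `ordMinimalDiscriminant`, `2` a uniformiser of
`O_v ≃ ℤ₂`).  Axioms: `propext`, `Classical.choice`, `Quot.sound`.
-/

open Polynomial IsLocalRing
open IsDiscreteValuationRing hiding maximalIdeal

namespace Literature.NumberTheory.DiophantineGeometry

namespace TateAlgorithm

namespace CharTwo

section Phases

variable {R : Type*} [CommRing R] [IsDomain R] [IsDiscreteValuationRing R]

/-- **Step 3 (type `II`), `2` a uniformiser, exact values**: on a model `a₁ = 2α`, `a₃ = 2γ`,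
`a₄ = 2q`, `a₆ = 2r` with `r ∈ Rˣ`: `ord Δ = 4` if `γ ∈ Rˣ`; otherwise `ord Δ = 6` if
`r + (α² + a₂)q ∈ Rˣ` and `ord Δ = 7` if not (`Δ = 2⁶((r + (α² + a₂)q)² + 2J)`, resp.
`Δ = 2⁷((α² + a₂)⁴q + 2J')` with `(α² + a₂)q ≡ -r` a unit).  Silverman, *ATAEC* IV.9.4 Step 3 with
`π = 2` (the identities of `addVal_Δ_toNat_le_seven_of_step3`). [cite: SilvermanATAEC1994, IV.9.4 Step 3] -/
theorem addVal_Δ_toNat_of_step3 (h2 : Irreducible (2 : R)) (W : WeierstrassCurve R)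
    {α γ q r : R} (hα : W.a₁ = 2 * α) (hγ : W.a₃ = 2 * γ) (hq : W.a₄ = 2 * q)
    (hr : W.a₆ = 2 * r) (hru : IsUnit r) :
    (IsUnit γ → (addVal R W.Δ).toNat = 4) ∧
    (¬ IsUnit γ → IsUnit (r + (α ^ 2 + W.a₂) * q) → (addVal R W.Δ).toNat = 6) ∧
    (¬ IsUnit γ → ¬ IsUnit (r + (α ^ 2 + W.a₂) * q) → (addVal R W.Δ).toNat = 7) := by
  refine ⟨fun hγu ↦ addVal_Δ_toNat_eq_four h2 W ⟨α, hα⟩ hγ hγu ⟨q, hq⟩ ⟨r, hr⟩,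
    fun hγu hT ↦ ?_, fun hγu hT ↦ ?_⟩
  · obtain ⟨γ₁, hγ₁⟩ := (not_isUnit_iff_dvd h2 _).mp hγu
    have e : W.Δ = 2 ^ 6 * ((r + (α ^ 2 + W.a₂) * q) ^ 2 + 2 *
      (-α ^ 6 * r + 2 * α ^ 5 * q * γ₁ - 3 * α ^ 4 * W.a₂ * r - 2 * α ^ 4 * W.a₂ * γ₁ ^ 2
       + 4 * α ^ 3 * W.a₂ * q * γ₁ + 18 * α ^ 3 * r * γ₁ + 4 * α ^ 3 * γ₁ ^ 3
       - 3 * α ^ 2 * W.a₂ ^ 2 * r - 4 * α ^ 2 * W.a₂ ^ 2 * γ₁ ^ 2 + 8 * α ^ 2 * q * r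
       - 30 * α ^ 2 * q * γ₁ ^ 2 + 2 * α * W.a₂ ^ 2 * q * γ₁ + 18 * α * W.a₂ * r * γ₁
       + 36 * α * W.a₂ * γ₁ ^ 3 - 24 * α * q ^ 2 * γ₁ - W.a₂ ^ 3 * r - 2 * W.a₂ ^ 3 * γ₁ ^ 2
       + 8 * W.a₂ * q * r + 18 * W.a₂ * q * γ₁ ^ 2 - 4 * q ^ 3 - 14 * r ^ 2
       - 54 * r * γ₁ ^ 2 - 54 * γ₁ ^ 4)) := by
      simp only [WeierstrassCurve.Δ, WeierstrassCurve.b₂, WeierstrassCurve.b₄,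
        WeierstrassCurve.b₆, WeierstrassCurve.b₈, hα, hγ, hγ₁, hq, hr]
      ring
    rw [addVal_toNat_eq_of_two h2 (hT.pow 2) e]
  · obtain ⟨γ₁, hγ₁⟩ := (not_isUnit_iff_dvd h2 _).mp hγu
    obtain ⟨s, hs⟩ := (not_isUnit_iff_dvd h2 _).mp hT
    have hr' : r = 2 * s - (α ^ 2 + W.a₂) * q := by linear_combination hs
    have hBq : IsUnit ((α ^ 2 + W.a₂) * q) := by
      have e : (α ^ 2 + W.a₂) * q = -r + 2 * s := by linear_combination hs
      rw [e]; exact isUnit_add_mul_of_isUnit h2 hru.neg s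
    have e : W.Δ = 2 ^ 7 * ((α ^ 2 + W.a₂) ^ 4 * q + 2 *
        (-α ^ 6 * s - 8 * α ^ 5 * q * γ₁ - α ^ 4 * W.a₂ * γ₁ ^ 2 - 3 * α ^ 4 * W.a₂ * s
         - 11 * α ^ 4 * q ^ 2 - 16 * α ^ 3 * W.a₂ * q * γ₁ + 2 * α ^ 3 * γ₁ ^ 3
         + 18 * α ^ 3 * γ₁ * s - 2 * α ^ 2 * W.a₂ ^ 2 * γ₁ ^ 2 - 3 * α ^ 2 * W.a₂ ^ 2 * s
         - 22 * α ^ 2 * W.a₂ * q ^ 2 + 12 * α ^ 2 * q * γ₁ ^ 2 + 36 * α ^ 2 * q * s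
         - 8 * α * W.a₂ ^ 2 * q * γ₁ + 18 * α * W.a₂ * γ₁ ^ 3 + 18 * α * W.a₂ * γ₁ * s
         - 12 * α * q ^ 2 * γ₁ - W.a₂ ^ 3 * γ₁ ^ 2 - W.a₂ ^ 3 * s - 11 * W.a₂ ^ 2 * q ^ 2
         + 36 * W.a₂ * q * γ₁ ^ 2 + 36 * W.a₂ * q * s - 2 * q ^ 3 - 27 * γ₁ ^ 4
         - 54 * γ₁ ^ 2 * s - 27 * s ^ 2)) := by
      simp only [WeierstrassCurve.Δ, WeierstrassCurve.b₂, WeierstrassCurve.b₄, WeierstrassCurve.b₆,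
        WeierstrassCurve.b₈, hα, hγ, hγ₁, hq, hr, hr']
      ring
    rw [addVal_toNat_eq_of_two h2 (((isUnit_of_mul_isUnit_left hBq).pow 4).mul
      (isUnit_of_mul_isUnit_right hBq)) e]

/-- **Step 3, the set of values: `ord Δ ∈ {4, 6, 7}`** on a model with `2 ∣ a₁, a₃, a₄, a₆`,
`4 ∤ a₆`. [cite: SilvermanATAEC1994, IV.9.4 Step 3 and Table 4.1] -/
theorem addVal_Δ_toNat_eq_of_step3 (h2 : Irreducible (2 : R)) (W : WeierstrassCurve R)
    (ha₁ : 2 ∣ W.a₁) (ha₃ : 2 ∣ W.a₃) (ha₄ : 2 ∣ W.a₄) (ha₆ : 2 ∣ W.a₆)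
    (h6 : ¬ 2 ^ 2 ∣ W.a₆) :
    (addVal R W.Δ).toNat = 4 ∨ (addVal R W.Δ).toNat = 6 ∨ (addVal R W.Δ).toNat = 7 := by
  obtain ⟨α, hα⟩ := ha₁
  obtain ⟨γ, hγ⟩ := ha₃
  obtain ⟨q, hq⟩ := ha₄
  obtain ⟨r, hr⟩ := ha₆
  have hru : IsUnit r := by
    rw [isUnit_iff_not_dvd h2]
    rintro ⟨r', hr'⟩
    exact h6 ⟨r', by rw [hr, hr']; ring⟩
  obtain ⟨h4, h6', h7⟩ := addVal_Δ_toNat_of_step3 h2 W hα hγ hq hr hru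
  by_cases hγu : IsUnit γ
  · exact Or.inl (h4 hγu)
  by_cases hT : IsUnit (r + (α ^ 2 + W.a₂) * q)
  · exact Or.inr (Or.inl (h6' hγu hT))
  · exact Or.inr (Or.inr (h7 hγu hT))

/-- **Step 4 (type `III`), `2` a uniformiser, exact values**: on a model `a₁ = 2α`, `a₃ = 2γ`,
`a₄ = 2q`, `a₆ = 4r₁` with `8 ∤ b₈`: `ord Δ = 4` if `γ ∈ Rˣ`; otherwise `γ = 2γ₁`, `q ∈ Rˣ`, and
`ord Δ = 6` if `α² + a₂ ∈ Rˣ`; otherwise `a₂ = 2β - α²` and `ord Δ = 8` if `βq + γ₁² + r₁ ∈ Rˣ`,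
`ord Δ = 9` if not.  Silverman, *ATAEC* IV.9.4 Step 4 with `π = 2` (the identities of
`addVal_Δ_toNat_le_nine_of_step4`). [cite: SilvermanATAEC1994, IV.9.4 Step 4] -/
theorem addVal_Δ_toNat_of_step4 (h2 : Irreducible (2 : R)) (W : WeierstrassCurve R)
    {α γ q r₁ : R} (hα : W.a₁ = 2 * α) (hγ : W.a₃ = 2 * γ) (hq : W.a₄ = 2 * q)
    (hr₁ : W.a₆ = 2 ^ 2 * r₁) (h8 : ¬ 2 ^ 3 ∣ W.b₈) :
    (IsUnit γ → (addVal R W.Δ).toNat = 4) ∧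
    (¬ IsUnit γ → IsUnit q) ∧
    (∀ γ₁ : R, γ = 2 * γ₁ → IsUnit (α ^ 2 + W.a₂) → (addVal R W.Δ).toNat = 6) ∧
    (∀ γ₁ β : R, γ = 2 * γ₁ → W.a₂ = 2 * β - α ^ 2 → IsUnit (β * q + γ₁ ^ 2 + r₁) →
      (addVal R W.Δ).toNat = 8) ∧
    (∀ γ₁ β : R, γ = 2 * γ₁ → W.a₂ = 2 * β - α ^ 2 → ¬ IsUnit (β * q + γ₁ ^ 2 + r₁) →
      (addVal R W.Δ).toNat = 9) := by
  have hqu_of : ∀ γ₁ : R, γ = 2 * γ₁ → IsUnit q := by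
    intro γ₁ hγ₁
    have hb₈ : W.b₈ = 2 ^ 2 * (-q ^ 2 +
        2 * (2 * α ^ 2 * r₁ - 2 * α * q * γ₁ + 2 * W.a₂ * γ₁ ^ 2 + 2 * W.a₂ * r₁)) := by
      simp only [WeierstrassCurve.b₈, hα, hγ, hγ₁, hq, hr₁]; ring
    have hqu : IsUnit q := by
      rw [isUnit_iff_not_dvd h2]
      rintro ⟨q', hq'⟩
      apply h8
      exact ⟨-2 * q' ^ 2 + 2 * α ^ 2 * r₁ - 4 * α * q' * γ₁ + 2 * W.a₂ * γ₁ ^ 2 + 2 * W.a₂ * r₁,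
        by rw [hb₈, hq']; ring⟩
    exact hqu
  refine ⟨fun hγu ↦ addVal_Δ_toNat_eq_four h2 W ⟨α, hα⟩ hγ hγu ⟨q, hq⟩ ⟨2 * r₁, by rw [hr₁]; ring⟩,
    fun hγu ↦ ?_, fun γ₁ hγ₁ hB ↦ ?_, fun γ₁ β hγ₁ ha₂ hT ↦ ?_, fun γ₁ β hγ₁ ha₂ hT ↦ ?_⟩
  · obtain ⟨γ₁, hγ₁⟩ := (not_isUnit_iff_dvd h2 _).mp hγu
    exact hqu_of γ₁ hγ₁
  · have hqu := hqu_of γ₁ hγ₁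
    have e : W.Δ = 2 ^ 6 * (((α ^ 2 + W.a₂) * q) ^ 2 + 2 *
      (-2 * α ^ 6 * r₁ + 2 * α ^ 5 * q * γ₁ - 2 * α ^ 4 * W.a₂ * γ₁ ^ 2
       - 6 * α ^ 4 * W.a₂ * r₁ + 4 * α ^ 3 * W.a₂ * q * γ₁ + 4 * α ^ 3 * γ₁ ^ 3
       + 36 * α ^ 3 * γ₁ * r₁ - 4 * α ^ 2 * W.a₂ ^ 2 * γ₁ ^ 2 - 6 * α ^ 2 * W.a₂ ^ 2 * r₁
       - 30 * α ^ 2 * q * γ₁ ^ 2 + 18 * α ^ 2 * q * r₁ + 2 * α * W.a₂ ^ 2 * q * γ₁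
       + 36 * α * W.a₂ * γ₁ ^ 3 + 36 * α * W.a₂ * γ₁ * r₁ - 24 * α * q ^ 2 * γ₁
       - 2 * W.a₂ ^ 3 * γ₁ ^ 2 - 2 * W.a₂ ^ 3 * r₁ + 18 * W.a₂ * q * γ₁ ^ 2
       + 18 * W.a₂ * q * r₁ - 4 * q ^ 3 - 54 * γ₁ ^ 4 - 108 * γ₁ ^ 2 * r₁ - 54 * r₁ ^ 2)) := by
      simp only [WeierstrassCurve.Δ, WeierstrassCurve.b₂, WeierstrassCurve.b₄,
        WeierstrassCurve.b₆, WeierstrassCurve.b₈, hα, hγ, hγ₁, hq, hr₁]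
      ring
    rw [addVal_toNat_eq_of_two h2 ((hB.mul hqu).pow 2) e]
  · have e : W.Δ = 2 ^ 8 * ((β * q + γ₁ ^ 2 + r₁) ^ 2 + 2 *
      (-8 * α ^ 3 * γ₁ ^ 3 - 12 * α ^ 2 * q * γ₁ ^ 2 + 2 * α ^ 2 * γ₁ ^ 2 * β ^ 2
       - 6 * α * q ^ 2 * γ₁ + 2 * α * q * γ₁ * β ^ 2 + 18 * α * γ₁ ^ 3 * β
       + 18 * α * γ₁ * r₁ * β - q ^ 3 + 8 * q * γ₁ ^ 2 * β + 8 * q * r₁ * β - 14 * γ₁ ^ 4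
       - 28 * γ₁ ^ 2 * r₁ - 4 * γ₁ ^ 2 * β ^ 3 - 14 * r₁ ^ 2 - 4 * r₁ * β ^ 3)) := by
      simp only [WeierstrassCurve.Δ, WeierstrassCurve.b₂, WeierstrassCurve.b₄,
        WeierstrassCurve.b₆, WeierstrassCurve.b₈, hα, hγ, hγ₁, hq, hr₁, ha₂]
      ring
    rw [addVal_toNat_eq_of_two h2 (hT.pow 2) e]
  · have hqu := hqu_of γ₁ hγ₁
    obtain ⟨s, hs⟩ := (not_isUnit_iff_dvd h2 _).mp hT
    have hr₁' : r₁ = 2 * s - γ₁ ^ 2 - β * q := by linear_combination hs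
    have e : W.Δ = 2 ^ 9 * (q ^ 3 + 2 *
        (-4 * α ^ 3 * γ₁ ^ 3 - 6 * α ^ 2 * q * γ₁ ^ 2 + α ^ 2 * γ₁ ^ 2 * β ^ 2
         - 3 * α * q ^ 2 * γ₁ - 8 * α * q * γ₁ * β ^ 2 + 18 * α * γ₁ * s * β - q ^ 3
         - 11 * q ^ 2 * β ^ 2 + 36 * q * s * β + 2 * q * β ^ 4 - 27 * s ^ 2 - 4 * s * β ^ 3)) := by
      simp only [WeierstrassCurve.Δ, WeierstrassCurve.b₂, WeierstrassCurve.b₄, WeierstrassCurve.b₆,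
        WeierstrassCurve.b₈, hα, hγ, hγ₁, hq, hr₁, ha₂, hr₁']
      ring
    rw [addVal_toNat_eq_of_two h2 (hqu.pow 3) e]

/-- **Step 4, the set of values: `ord Δ ∈ {4, 6, 8, 9}`** on a model with `2 ∣ a₁, a₃, a₄`,
`4 ∣ a₆`, `8 ∤ b₈`. [cite: SilvermanATAEC1994, IV.9.4 Step 4 and Table 4.1] -/
theorem addVal_Δ_toNat_eq_of_step4 (h2 : Irreducible (2 : R)) (W : WeierstrassCurve R)
    (ha₁ : 2 ∣ W.a₁) (ha₃ : 2 ∣ W.a₃) (ha₄ : 2 ∣ W.a₄) (ha₆ : 2 ^ 2 ∣ W.a₆)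
    (h8 : ¬ 2 ^ 3 ∣ W.b₈) :
    (addVal R W.Δ).toNat = 4 ∨ (addVal R W.Δ).toNat = 6 ∨ (addVal R W.Δ).toNat = 8 ∨
      (addVal R W.Δ).toNat = 9 := by
  obtain ⟨α, hα⟩ := ha₁
  obtain ⟨γ, hγ⟩ := ha₃
  obtain ⟨q, hq⟩ := ha₄
  obtain ⟨r₁, hr₁⟩ := ha₆
  obtain ⟨h4, -, h6, h8', h9⟩ := addVal_Δ_toNat_of_step4 h2 W hα hγ hq hr₁ h8
  by_cases hγu : IsUnit γ
  · exact Or.inl (h4 hγu)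
  obtain ⟨γ₁, hγ₁⟩ := (not_isUnit_iff_dvd h2 _).mp hγu
  by_cases hB : IsUnit (α ^ 2 + W.a₂)
  · exact Or.inr (Or.inl (h6 γ₁ hγ₁ hB))
  obtain ⟨β, hβ⟩ := (not_isUnit_iff_dvd h2 _).mp hB
  have ha₂ : W.a₂ = 2 * β - α ^ 2 := by linear_combination hβ
  by_cases hT : IsUnit (β * q + γ₁ ^ 2 + r₁)
  · exact Or.inr (Or.inr (Or.inl (h8' γ₁ β hγ₁ ha₂ hT)))
  · exact Or.inr (Or.inr (Or.inr (h9 γ₁ β hγ₁ ha₂ hT)))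

/-- **Step 6 (type `I₀*`), `2` a uniformiser, exact values**: on a Step-6 model `a₁ = 2α`,
`a₂ = 2p`, `a₃ = 4γ`, `a₄ = 4q`, `a₆ = 8r` with `pq + r ∈ Rˣ` (three distinct roots):
`ord Δ = 8` if `α²q + γ² ∈ Rˣ`; otherwise `ord Δ = 9` if `α ∈ Rˣ` and `ord Δ = 10` if not.
Silverman, *ATAEC* IV.9.4 Step 6 with `π = 2` (the identities of `addVal_Δ_toNat_le_ten_of_step6`).
[cite: SilvermanATAEC1994, IV.9.4 Step 6] -/
theorem addVal_Δ_toNat_of_step6 (h2 : Irreducible (2 : R)) (W : WeierstrassCurve R)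
    {α p γ q r : R} (ha₁ : W.a₁ = 2 * α) (ha₂ : W.a₂ = 2 * p) (ha₃ : W.a₃ = 2 ^ 2 * γ)
    (ha₄ : W.a₄ = 2 ^ 2 * q) (ha₆ : W.a₆ = 2 ^ 3 * r) (hI : IsUnit (p * q + r)) :
    (IsUnit (α ^ 2 * q + γ ^ 2) → (addVal R W.Δ).toNat = 8) ∧
    (¬ IsUnit (α ^ 2 * q + γ ^ 2) → IsUnit α → (addVal R W.Δ).toNat = 9) ∧
    (¬ IsUnit (α ^ 2 * q + γ ^ 2) → ¬ IsUnit α → (addVal R W.Δ).toNat = 10) := by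
  refine ⟨fun hT ↦ ?_, fun hT hαu ↦ ?_, fun hT hαu ↦ ?_⟩
  · have e : W.Δ = 2 ^ 8 * ((α ^ 2 * q + γ ^ 2) ^ 2 + 2 *
      (-α ^ 6 * r + α ^ 5 * γ * q - α ^ 4 * p * γ ^ 2 - 6 * α ^ 4 * p * r
       + 4 * α ^ 3 * p * γ * q + α ^ 3 * γ ^ 3 + 18 * α ^ 3 * γ * r
       - 4 * α ^ 2 * p ^ 2 * γ ^ 2 - 12 * α ^ 2 * p ^ 2 * r + 2 * α ^ 2 * p * q ^ 2
       - 16 * α ^ 2 * γ ^ 2 * q + 18 * α ^ 2 * q * r + 4 * α * p ^ 2 * γ * q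
       + 18 * α * p * γ ^ 3 + 36 * α * p * γ * r - 24 * α * γ * q ^ 2 - 4 * p ^ 3 * γ ^ 2
       - 8 * p ^ 3 * r + 2 * p ^ 2 * q ^ 2 + 18 * p * γ ^ 2 * q + 36 * p * q * r
       - 14 * γ ^ 4 - 54 * γ ^ 2 * r - 8 * q ^ 3 - 54 * r ^ 2)) := by
      simp only [WeierstrassCurve.Δ, WeierstrassCurve.b₂, WeierstrassCurve.b₄,
        WeierstrassCurve.b₆, WeierstrassCurve.b₈, ha₁, ha₂, ha₃, ha₄, ha₆]
      ring
    rw [addVal_toNat_eq_of_two h2 (hT.pow 2) e]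
  · obtain ⟨ε, hε⟩ := (not_isUnit_iff_dvd h2 _).mp hT
    have hX : IsUnit (α ^ 2 * r - p * γ ^ 2) := by
      have e : α ^ 2 * r - p * γ ^ 2 = α ^ 2 * (p * q + r) + 2 * (-(p * ε)) := by
        linear_combination (-p) * hε
      rw [e]; exact isUnit_add_mul_of_isUnit h2 ((hαu.pow 2).mul hI) _
    have e : α ^ 6 * W.Δ = 2 ^ 9 * (α ^ 10 * (α ^ 2 * r - p * γ ^ 2) + 2 *
      (-α ^ 12 * r - 3 * α ^ 10 * p * r + 9 * α ^ 9 * γ * r + α ^ 9 * γ * ε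
       - 2 * α ^ 8 * p ^ 2 * γ ^ 2 - 6 * α ^ 8 * p ^ 2 * r + 7 * α ^ 7 * p * γ ^ 3
       + 18 * α ^ 7 * p * γ * r + 4 * α ^ 7 * p * γ * ε - 2 * α ^ 6 * p ^ 3 * γ ^ 2
       - 4 * α ^ 6 * p ^ 3 * r + α ^ 6 * γ ^ 4 - 36 * α ^ 6 * γ ^ 2 * r
       - 16 * α ^ 6 * γ ^ 2 * ε - 27 * α ^ 6 * r ^ 2 + 18 * α ^ 6 * r * ε + α ^ 6 * ε ^ 2
       - 2 * α ^ 5 * p ^ 2 * γ ^ 3 + 4 * α ^ 5 * p ^ 2 * γ * ε - 8 * α ^ 4 * p * γ ^ 4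
       - 18 * α ^ 4 * p * γ ^ 2 * r + 14 * α ^ 4 * p * γ ^ 2 * ε + 36 * α ^ 4 * p * r * ε
       + 4 * α ^ 4 * p * ε ^ 2 - 12 * α ^ 3 * γ ^ 5 + 48 * α ^ 3 * γ ^ 3 * ε
       - 48 * α ^ 3 * γ * ε ^ 2 + α ^ 2 * p ^ 2 * γ ^ 4 - 4 * α ^ 2 * p ^ 2 * γ ^ 2 * ε
       + 4 * α ^ 2 * p ^ 2 * ε ^ 2 + 4 * γ ^ 6 - 24 * γ ^ 4 * ε + 48 * γ ^ 2 * ε ^ 2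
       - 32 * ε ^ 3)) := by
      simp only [WeierstrassCurve.Δ, WeierstrassCurve.b₂, WeierstrassCurve.b₄,
        WeierstrassCurve.b₆, WeierstrassCurve.b₈, ha₁, ha₂, ha₃, ha₄, ha₆]
      linear_combination
        (512 * α ^ 9 * γ + 256 * α ^ 8 * q + 2048 * α ^ 7 * p * γ + 1024 * α ^ 6 * p * q
         - 7936 * α ^ 6 * γ ^ 2 + 9216 * α ^ 6 * r + 512 * α ^ 6 * ε
         + 2048 * α ^ 5 * p ^ 2 * γ - 12288 * α ^ 5 * γ * q + 1024 * α ^ 4 * p ^ 2 * q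
         + 8192 * α ^ 4 * p * γ ^ 2 + 18432 * α ^ 4 * p * r + 2048 * α ^ 4 * p * ε
         - 4096 * α ^ 4 * q ^ 2 + 12288 * α ^ 3 * γ ^ 3 - 24576 * α ^ 3 * γ * ε
         - 1024 * α ^ 2 * p ^ 2 * γ ^ 2 + 2048 * α ^ 2 * p ^ 2 * ε
         + 4096 * α ^ 2 * γ ^ 2 * q - 8192 * α ^ 2 * q * ε - 4096 * γ ^ 4
         + 16384 * γ ^ 2 * ε - 16384 * ε ^ 2) * hε
    rw [addVal_toNat_eq_of_eq_add h2 (hαu.pow 6) ((hαu.pow 10).mul hX) e]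
  · obtain ⟨ε, hε⟩ := (not_isUnit_iff_dvd h2 _).mp hT
    obtain ⟨α₁, hα₁⟩ := (not_isUnit_iff_dvd h2 _).mp hαu
    have hγ2 : (2 : R) ∣ γ := by
      have h : (2 : R) ∣ γ ^ 2 := ⟨ε - 2 * α₁ ^ 2 * q, by rw [hα₁] at hε; linear_combination hε⟩
      exact h2.prime.dvd_of_dvd_pow h
    obtain ⟨γ₁, hγ₁⟩ := hγ2
    have e : W.Δ = 2 ^ 10 * ((p * q + r) ^ 2 + 2 *
        (-2 * p ^ 3 * r - 4 * p ^ 3 * γ₁ ^ 2 + 4 * p ^ 2 * q * α₁ * γ₁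
         - 12 * p ^ 2 * r * α₁ ^ 2 - 16 * p ^ 2 * α₁ ^ 2 * γ₁ ^ 2 + 2 * p * q ^ 2 * α₁ ^ 2
         + 8 * p * q * r + 16 * p * q * α₁ ^ 3 * γ₁ + 18 * p * q * γ₁ ^ 2
         - 24 * p * r * α₁ ^ 4 + 36 * p * r * α₁ * γ₁ - 16 * p * α₁ ^ 4 * γ₁ ^ 2
         + 72 * p * α₁ * γ₁ ^ 3 - 2 * q ^ 3 + 2 * q ^ 2 * α₁ ^ 4 - 24 * q ^ 2 * α₁ * γ₁
         + 18 * q * r * α₁ ^ 2 + 16 * q * α₁ ^ 5 * γ₁ - 60 * q * α₁ ^ 2 * γ₁ ^ 2 - 14 * r ^ 2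
         - 16 * r * α₁ ^ 6 + 72 * r * α₁ ^ 3 * γ₁ - 54 * r * γ₁ ^ 2 + 16 * α₁ ^ 3 * γ₁ ^ 3
         - 54 * γ₁ ^ 4)) := by
      simp only [WeierstrassCurve.Δ, WeierstrassCurve.b₂, WeierstrassCurve.b₄, WeierstrassCurve.b₆,
        WeierstrassCurve.b₈, ha₁, ha₂, ha₃, ha₄, ha₆, hα₁, hγ₁]
      ring
    rw [addVal_toNat_eq_of_two h2 (hI.pow 2) e]

/-- **Step 6, the set of values: `ord Δ ∈ {8, 9, 10}`**. [cite: SilvermanATAEC1994, IV.9.4 Step 6 and Table 4.1] -/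
theorem addVal_Δ_toNat_eq_of_step6 (h2 : Irreducible (2 : R)) (W : WeierstrassCurve R)
    {α p γ q r : R} (ha₁ : W.a₁ = 2 * α) (ha₂ : W.a₂ = 2 * p) (ha₃ : W.a₃ = 2 ^ 2 * γ)
    (ha₄ : W.a₄ = 2 ^ 2 * q) (ha₆ : W.a₆ = 2 ^ 3 * r) (hI : IsUnit (p * q + r)) :
    (addVal R W.Δ).toNat = 8 ∨ (addVal R W.Δ).toNat = 9 ∨ (addVal R W.Δ).toNat = 10 := by
  obtain ⟨h8, h9, h10⟩ := addVal_Δ_toNat_of_step6 h2 W ha₁ ha₂ ha₃ ha₄ ha₆ hI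
  by_cases hT : IsUnit (α ^ 2 * q + γ ^ 2)
  · exact Or.inl (h8 hT)
  by_cases hαu : IsUnit α
  · exact Or.inr (Or.inl (h9 hT hαu))
  · exact Or.inr (Or.inr (h10 hT hαu))

/-- **Step 9 (type `III*`), `2` a uniformiser, exact values**: on a Step-9 model `a₁ = 2α`,
`a₂ = 4p`, `a₃ = 8γ`, `a₄ = 8q`, `a₆ = 32r` with `q ∈ Rˣ` (`16 ∤ a₄`): `ord Δ = 10` if `α ∈ Rˣ`;
otherwise `α = 2α₁` and `ord Δ = 12` if `γ ∈ Rˣ`; otherwise `γ = 2γ₁` and `ord Δ = 14` if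
`r + (α₁² + p)q ∈ Rˣ`, `ord Δ = 15` if not.  Silverman, *ATAEC* IV.9.4 Step 9 with `π = 2` (the
identities of `addVal_Δ_toNat_le_fifteen_of_step9`). [cite: SilvermanATAEC1994, IV.9.4 Step 9] -/
theorem addVal_Δ_toNat_of_step9 (h2 : Irreducible (2 : R)) (W : WeierstrassCurve R)
    {α p γ q r : R} (hα : W.a₁ = 2 * α) (hp : W.a₂ = 2 ^ 2 * p) (hγ : W.a₃ = 2 ^ 3 * γ)
    (hq : W.a₄ = 2 ^ 3 * q) (hr : W.a₆ = 2 ^ 5 * r) (hqu : IsUnit q) :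
    (IsUnit α → (addVal R W.Δ).toNat = 10) ∧
    (∀ α₁ : R, α = 2 * α₁ → IsUnit γ → (addVal R W.Δ).toNat = 12) ∧
    (∀ α₁ γ₁ : R, α = 2 * α₁ → γ = 2 * γ₁ → IsUnit (r + (α₁ ^ 2 + p) * q) →
      (addVal R W.Δ).toNat = 14) ∧
    (∀ α₁ γ₁ : R, α = 2 * α₁ → γ = 2 * γ₁ → ¬ IsUnit (r + (α₁ ^ 2 + p) * q) →
      (addVal R W.Δ).toNat = 15) := by
  refine ⟨fun hαu ↦ ?_, fun α₁ hα₁ hγu ↦ ?_, fun α₁ γ₁ hα₁ hγ₁ hT ↦ ?_,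
    fun α₁ γ₁ hα₁ hγ₁ hT ↦ ?_⟩
  · have e : W.Δ = 2 ^ 10 * (α ^ 4 * q ^ 2 + 2 *
      (-α ^ 6 * r + α ^ 5 * γ * q - 2 * α ^ 4 * p * γ ^ 2 - 12 * α ^ 4 * p * r
       + 8 * α ^ 3 * p * γ * q + 2 * α ^ 3 * γ ^ 3 + 36 * α ^ 3 * γ * r
       - 16 * α ^ 2 * p ^ 2 * γ ^ 2 - 48 * α ^ 2 * p ^ 2 * r + 4 * α ^ 2 * p * q ^ 2
       - 30 * α ^ 2 * γ ^ 2 * q + 36 * α ^ 2 * q * r + 16 * α * p ^ 2 * γ * q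
       + 72 * α * p * γ ^ 3 + 144 * α * p * γ * r - 48 * α * γ * q ^ 2 - 32 * p ^ 3 * γ ^ 2
       - 64 * p ^ 3 * r + 8 * p ^ 2 * q ^ 2 + 72 * p * γ ^ 2 * q + 144 * p * q * r
       - 54 * γ ^ 4 - 216 * γ ^ 2 * r - 16 * q ^ 3 - 216 * r ^ 2)) := by
      simp only [WeierstrassCurve.Δ, WeierstrassCurve.b₂, WeierstrassCurve.b₄,
        WeierstrassCurve.b₆, WeierstrassCurve.b₈, hα, hp, hγ, hq, hr]
      ring
    rw [addVal_toNat_eq_of_two h2 ((hαu.pow 4).mul (hqu.pow 2)) e]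
  · have e : W.Δ = 2 ^ 12 * (γ ^ 4 + 2 *
      (-8 * p ^ 3 * γ ^ 2 - 16 * p ^ 3 * r - 16 * p ^ 2 * γ ^ 2 * α₁ ^ 2
       + 8 * p ^ 2 * γ * q * α₁ + 2 * p ^ 2 * q ^ 2 - 48 * p ^ 2 * r * α₁ ^ 2
       + 36 * p * γ ^ 3 * α₁ + 18 * p * γ ^ 2 * q - 8 * p * γ ^ 2 * α₁ ^ 4
       + 16 * p * γ * q * α₁ ^ 3 + 72 * p * γ * r * α₁ + 4 * p * q ^ 2 * α₁ ^ 2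
       + 36 * p * q * r - 48 * p * r * α₁ ^ 4 - 14 * γ ^ 4 + 4 * γ ^ 3 * α₁ ^ 3
       - 30 * γ ^ 2 * q * α₁ ^ 2 - 54 * γ ^ 2 * r - 24 * γ * q ^ 2 * α₁ + 8 * γ * q * α₁ ^ 5
       + 72 * γ * r * α₁ ^ 3 - 4 * q ^ 3 + 2 * q ^ 2 * α₁ ^ 4 + 36 * q * r * α₁ ^ 2
       - 54 * r ^ 2 - 16 * r * α₁ ^ 6)) := by
      simp only [WeierstrassCurve.Δ, WeierstrassCurve.b₂, WeierstrassCurve.b₄,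
        WeierstrassCurve.b₆, WeierstrassCurve.b₈, hα, hp, hγ, hq, hr, hα₁]
      ring
    rw [addVal_toNat_eq_of_two h2 (hγu.pow 4) e]
  · have e : W.Δ = 2 ^ 14 * ((r + (α₁ ^ 2 + p) * q) ^ 2 + 2 *
      (-4 * p ^ 3 * r - 8 * p ^ 3 * γ₁ ^ 2 + 4 * p ^ 2 * q * α₁ * γ₁
       - 12 * p ^ 2 * r * α₁ ^ 2 - 16 * p ^ 2 * α₁ ^ 2 * γ₁ ^ 2 + 8 * p * q * r
       + 8 * p * q * α₁ ^ 3 * γ₁ + 18 * p * q * γ₁ ^ 2 - 12 * p * r * α₁ ^ 4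
       + 36 * p * r * α₁ * γ₁ - 8 * p * α₁ ^ 4 * γ₁ ^ 2 + 72 * p * α₁ * γ₁ ^ 3 - q ^ 3
       - 12 * q ^ 2 * α₁ * γ₁ + 8 * q * r * α₁ ^ 2 + 4 * q * α₁ ^ 5 * γ₁
       - 30 * q * α₁ ^ 2 * γ₁ ^ 2 - 14 * r ^ 2 - 4 * r * α₁ ^ 6 + 36 * r * α₁ ^ 3 * γ₁
       - 54 * r * γ₁ ^ 2 + 8 * α₁ ^ 3 * γ₁ ^ 3 - 54 * γ₁ ^ 4)) := by
      simp only [WeierstrassCurve.Δ, WeierstrassCurve.b₂, WeierstrassCurve.b₄,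
        WeierstrassCurve.b₆, WeierstrassCurve.b₈, hα, hp, hγ, hq, hr, hα₁, hγ₁]
      ring
    rw [addVal_toNat_eq_of_two h2 (hT.pow 2) e]
  · obtain ⟨s, hs⟩ := (not_isUnit_iff_dvd h2 _).mp hT
    have hr' : r = 2 * s - (α₁ ^ 2 + p) * q := by linear_combination hs
    have e : W.Δ = 2 ^ 15 * (q ^ 3 + 2 *
        (2 * p ^ 4 * q + 8 * p ^ 3 * q * α₁ ^ 2 - 4 * p ^ 3 * γ₁ ^ 2 - 4 * p ^ 3 * s
         - 11 * p ^ 2 * q ^ 2 + 12 * p ^ 2 * q * α₁ ^ 4 - 16 * p ^ 2 * q * α₁ * γ₁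
         - 8 * p ^ 2 * α₁ ^ 2 * γ₁ ^ 2 - 12 * p ^ 2 * α₁ ^ 2 * s - 22 * p * q ^ 2 * α₁ ^ 2
         + 8 * p * q * α₁ ^ 6 - 32 * p * q * α₁ ^ 3 * γ₁ + 36 * p * q * γ₁ ^ 2
         + 36 * p * q * s - 4 * p * α₁ ^ 4 * γ₁ ^ 2 - 12 * p * α₁ ^ 4 * s
         + 36 * p * α₁ * γ₁ ^ 3 + 36 * p * α₁ * γ₁ * s - q ^ 3 - 11 * q ^ 2 * α₁ ^ 4
         - 6 * q ^ 2 * α₁ * γ₁ + 2 * q * α₁ ^ 8 - 16 * q * α₁ ^ 5 * γ₁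
         + 12 * q * α₁ ^ 2 * γ₁ ^ 2 + 36 * q * α₁ ^ 2 * s - 4 * α₁ ^ 6 * s
         + 4 * α₁ ^ 3 * γ₁ ^ 3 + 36 * α₁ ^ 3 * γ₁ * s - 27 * γ₁ ^ 4 - 54 * γ₁ ^ 2 * s
         - 27 * s ^ 2)) := by
      simp only [WeierstrassCurve.Δ, WeierstrassCurve.b₂, WeierstrassCurve.b₄, WeierstrassCurve.b₆,
        WeierstrassCurve.b₈, hα, hp, hγ, hq, hr, hα₁, hγ₁, hr']
      ring
    rw [addVal_toNat_eq_of_two h2 (hqu.pow 3) e]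

/-- **Step 9, the set of values: `ord Δ ∈ {10, 12, 14, 15}`** on a model with `2 ∣ a₁`, `4 ∣ a₂`,
`8 ∣ a₃`, `8 ∣ a₄`, `32 ∣ a₆`, `16 ∤ a₄`. [cite: SilvermanATAEC1994, IV.9.4 Step 9 and Table 4.1] -/
theorem addVal_Δ_toNat_eq_of_step9 (h2 : Irreducible (2 : R)) (W : WeierstrassCurve R)
    (ha₁ : 2 ∣ W.a₁) (ha₂ : 2 ^ 2 ∣ W.a₂) (ha₃ : 2 ^ 3 ∣ W.a₃) (ha₄ : 2 ^ 3 ∣ W.a₄)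
    (ha₆ : 2 ^ 5 ∣ W.a₆) (h9 : ¬ 2 ^ 4 ∣ W.a₄) :
    (addVal R W.Δ).toNat = 10 ∨ (addVal R W.Δ).toNat = 12 ∨ (addVal R W.Δ).toNat = 14 ∨
      (addVal R W.Δ).toNat = 15 := by
  obtain ⟨α, hα⟩ := ha₁
  obtain ⟨p, hp⟩ := ha₂
  obtain ⟨γ, hγ⟩ := ha₃
  obtain ⟨q, hq⟩ := ha₄
  obtain ⟨r, hr⟩ := ha₆
  have hqu : IsUnit q := by
    rw [isUnit_iff_not_dvd h2]
    rintro ⟨q', hq'⟩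
    exact h9 ⟨q', by rw [hq, hq']; ring⟩
  obtain ⟨h10, h12, h14, h15⟩ := addVal_Δ_toNat_of_step9 h2 W hα hp hγ hq hr hqu
  by_cases hαu : IsUnit α
  · exact Or.inl (h10 hαu)
  obtain ⟨α₁, hα₁⟩ := (not_isUnit_iff_dvd h2 _).mp hαu
  by_cases hγu : IsUnit γ
  · exact Or.inr (Or.inl (h12 α₁ hα₁ hγu))
  obtain ⟨γ₁, hγ₁⟩ := (not_isUnit_iff_dvd h2 _).mp hγu
  by_cases hT : IsUnit (r + (α₁ ^ 2 + p) * q)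
  · exact Or.inr (Or.inr (Or.inl (h14 α₁ γ₁ hα₁ hγ₁ hT)))
  · exact Or.inr (Or.inr (Or.inr (h15 α₁ γ₁ hα₁ hγ₁ hT)))

/-- **Step 10 (type `II*`), `2` a uniformiser, exact values**: on a Step-10 model `a₁ = 2α`,
`a₂ = 4p`, `a₃ = 8γ`, `a₄ = 16q`, `a₆ = 32r` with `r ∈ Rˣ` (`64 ∤ a₆`): `ord Δ = 11` if `α ∈ Rˣ`;
otherwise `ord Δ = 12` if `γ ∈ Rˣ` and `ord Δ = 14` if not.  Silverman, *ATAEC* IV.9.4 Step 10 with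
`π = 2` (the identities of `addVal_Δ_toNat_le_fourteen_of_step10`). [cite: SilvermanATAEC1994, IV.9.4 Step 10] -/
theorem addVal_Δ_toNat_of_step10 (h2 : Irreducible (2 : R)) (W : WeierstrassCurve R)
    {α p γ q r : R} (hα : W.a₁ = 2 * α) (hp : W.a₂ = 2 ^ 2 * p) (hγ : W.a₃ = 2 ^ 3 * γ)
    (hq : W.a₄ = 2 ^ 4 * q) (hr : W.a₆ = 2 ^ 5 * r) (hru : IsUnit r) :
    (IsUnit α → (addVal R W.Δ).toNat = 11) ∧
    (∀ α₁ : R, α = 2 * α₁ → IsUnit γ → (addVal R W.Δ).toNat = 12) ∧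
    (∀ α₁ γ₁ : R, α = 2 * α₁ → γ = 2 * γ₁ → (addVal R W.Δ).toNat = 14) := by
  refine ⟨fun hαu ↦ ?_, fun α₁ hα₁ hγu ↦ ?_, fun α₁ γ₁ hα₁ hγ₁ ↦ ?_⟩
  · have e : W.Δ = 2 ^ 11 * (α ^ 6 * r + 2 *
      (-α ^ 6 * r + α ^ 5 * γ * q - α ^ 4 * p * γ ^ 2 - 6 * α ^ 4 * p * r + α ^ 4 * q ^ 2
       + 8 * α ^ 3 * p * γ * q + α ^ 3 * γ ^ 3 + 18 * α ^ 3 * γ * r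
       - 8 * α ^ 2 * p ^ 2 * γ ^ 2 - 24 * α ^ 2 * p ^ 2 * r + 8 * α ^ 2 * p * q ^ 2
       - 30 * α ^ 2 * γ ^ 2 * q + 36 * α ^ 2 * q * r + 16 * α * p ^ 2 * γ * q
       + 36 * α * p * γ ^ 3 + 72 * α * p * γ * r - 96 * α * γ * q ^ 2 - 16 * p ^ 3 * γ ^ 2
       - 32 * p ^ 3 * r + 16 * p ^ 2 * q ^ 2 + 72 * p * γ ^ 2 * q + 144 * p * q * r
       - 27 * γ ^ 4 - 108 * γ ^ 2 * r - 64 * q ^ 3 - 108 * r ^ 2)) := by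
      simp only [WeierstrassCurve.Δ, WeierstrassCurve.b₂, WeierstrassCurve.b₄,
        WeierstrassCurve.b₆, WeierstrassCurve.b₈, hα, hp, hγ, hq, hr]
      ring
    rw [addVal_toNat_eq_of_two h2 ((hαu.pow 6).mul hru) e]
  · have e : W.Δ = 2 ^ 12 * (γ ^ 4 + 2 *
      (-8 * p ^ 3 * γ ^ 2 - 16 * p ^ 3 * r - 16 * p ^ 2 * γ ^ 2 * α₁ ^ 2
       + 16 * p ^ 2 * γ * q * α₁ + 8 * p ^ 2 * q ^ 2 - 48 * p ^ 2 * r * α₁ ^ 2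
       + 36 * p * γ ^ 3 * α₁ + 36 * p * γ ^ 2 * q - 8 * p * γ ^ 2 * α₁ ^ 4
       + 32 * p * γ * q * α₁ ^ 3 + 72 * p * γ * r * α₁ + 16 * p * q ^ 2 * α₁ ^ 2
       + 72 * p * q * r - 48 * p * r * α₁ ^ 4 - 14 * γ ^ 4 + 4 * γ ^ 3 * α₁ ^ 3
       - 60 * γ ^ 2 * q * α₁ ^ 2 - 54 * γ ^ 2 * r - 96 * γ * q ^ 2 * α₁
       + 16 * γ * q * α₁ ^ 5 + 72 * γ * r * α₁ ^ 3 - 32 * q ^ 3 + 8 * q ^ 2 * α₁ ^ 4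
       + 72 * q * r * α₁ ^ 2 - 54 * r ^ 2 - 16 * r * α₁ ^ 6)) := by
      simp only [WeierstrassCurve.Δ, WeierstrassCurve.b₂, WeierstrassCurve.b₄,
        WeierstrassCurve.b₆, WeierstrassCurve.b₈, hα, hp, hγ, hq, hr, hα₁]
      ring
    rw [addVal_toNat_eq_of_two h2 (hγu.pow 4) e]
  · have e : W.Δ = 2 ^ 14 * (r ^ 2 + 2 *
        (-4 * p ^ 3 * r - 8 * p ^ 3 * γ₁ ^ 2 + 2 * p ^ 2 * q ^ 2 + 8 * p ^ 2 * q * α₁ * γ₁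
         - 12 * p ^ 2 * r * α₁ ^ 2 - 16 * p ^ 2 * α₁ ^ 2 * γ₁ ^ 2 + 4 * p * q ^ 2 * α₁ ^ 2
         + 18 * p * q * r + 16 * p * q * α₁ ^ 3 * γ₁ + 36 * p * q * γ₁ ^ 2
         - 12 * p * r * α₁ ^ 4 + 36 * p * r * α₁ * γ₁ - 8 * p * α₁ ^ 4 * γ₁ ^ 2
         + 72 * p * α₁ * γ₁ ^ 3 - 8 * q ^ 3 + 2 * q ^ 2 * α₁ ^ 4 - 48 * q ^ 2 * α₁ * γ₁
         + 18 * q * r * α₁ ^ 2 + 8 * q * α₁ ^ 5 * γ₁ - 60 * q * α₁ ^ 2 * γ₁ ^ 2 - 14 * r ^ 2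
         - 4 * r * α₁ ^ 6 + 36 * r * α₁ ^ 3 * γ₁ - 54 * r * γ₁ ^ 2 + 8 * α₁ ^ 3 * γ₁ ^ 3
         - 54 * γ₁ ^ 4)) := by
      simp only [WeierstrassCurve.Δ, WeierstrassCurve.b₂, WeierstrassCurve.b₄, WeierstrassCurve.b₆,
        WeierstrassCurve.b₈, hα, hp, hγ, hq, hr, hα₁, hγ₁]
      ring
    rw [addVal_toNat_eq_of_two h2 (hru.pow 2) e]

/-- **Step 10, the set of values: `ord Δ ∈ {11, 12, 14}`** on a model with `2 ∣ a₁`, `4 ∣ a₂`,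
`8 ∣ a₃`, `16 ∣ a₄`, `32 ∣ a₆`, `64 ∤ a₆`. [cite: SilvermanATAEC1994, IV.9.4 Step 10 and Table 4.1] -/
theorem addVal_Δ_toNat_eq_of_step10 (h2 : Irreducible (2 : R)) (W : WeierstrassCurve R)
    (ha₁ : 2 ∣ W.a₁) (ha₂ : 2 ^ 2 ∣ W.a₂) (ha₃ : 2 ^ 3 ∣ W.a₃) (ha₄ : 2 ^ 4 ∣ W.a₄)
    (ha₆ : 2 ^ 5 ∣ W.a₆) (h10 : ¬ 2 ^ 6 ∣ W.a₆) :
    (addVal R W.Δ).toNat = 11 ∨ (addVal R W.Δ).toNat = 12 ∨ (addVal R W.Δ).toNat = 14 := by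
  obtain ⟨α, hα⟩ := ha₁
  obtain ⟨p, hp⟩ := ha₂
  obtain ⟨γ, hγ⟩ := ha₃
  obtain ⟨q, hq⟩ := ha₄
  obtain ⟨r, hr⟩ := ha₆
  have hru : IsUnit r := by
    rw [isUnit_iff_not_dvd h2]
    rintro ⟨r', hr'⟩
    exact h10 ⟨r', by rw [hr, hr']; ring⟩
  obtain ⟨h11, h12, h14⟩ := addVal_Δ_toNat_of_step10 h2 W hα hp hγ hq hr hru
  by_cases hαu : IsUnit α
  · exact Or.inl (h11 hαu)
  obtain ⟨α₁, hα₁⟩ := (not_isUnit_iff_dvd h2 _).mp hαu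
  by_cases hγu : IsUnit γ
  · exact Or.inr (Or.inl (h12 α₁ hα₁ hγu))
  obtain ⟨γ₁, hγ₁⟩ := (not_isUnit_iff_dvd h2 _).mp hγu
  exact Or.inr (Or.inr (h14 α₁ γ₁ hα₁ hγ₁))

end Phases

end CharTwo

end TateAlgorithm

end Literature.NumberTheory.DiophantineGeometry

/-! ### §2. The values of `ord Δ` on each type, for a minimal equation (`2` a uniformiser) -/

namespace Literature.NumberTheory.EllipticCurves

namespace LocalIndex

open IsLocalRing
open IsDiscreteValuationRing hiding maximalIdeal
open DiophantineGeometry DiophantineGeometry.TateAlgorithm DiophantineGeometry.TateAlgorithm.CharTwo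

variable {R : Type*} [CommRing R] [IsDomain R] [IsDiscreteValuationRing R]

/-- **Type `II` when `2` is a uniformiser: `ord Δ ∈ {4, 6, 7}`.**  The Step-2 model
(`kodairaSymbolOfMinimal_eq_II_imp`: `2 ∣ a₃, a₄, a₆`, `2 ∣ b₂` so `2 ∣ a₁`, `4 ∤ a₆`) and
`CharTwo.addVal_Δ_toNat_eq_of_step3`.  Silverman, *ATAEC* IV.9.4 Step 3 with `π = 2`.
[cite: SilvermanATAEC1994, IV.9.4 Step 3 and Table 4.1] -/
theorem addVal_Δ_toNat_eq_of_kodairaSymbolOfMinimal_eq_II_of_two [PerfectField (ResidueField R)]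
    (h2 : Irreducible (2 : R)) (V : WeierstrassCurve R) (hV : V.kodairaSymbolOfMinimal = .II) :
    (addVal R V.Δ).toNat = 4 ∨ (addVal R V.Δ).toNat = 6 ∨ (addVal R V.Δ).toNat = 7 := by
  obtain ⟨hΔm, hb₂, ha₆⟩ := kodairaSymbolOfMinimal_eq_II_imp V hV
  have hm : ∀ {x : R}, x ∈ maximalIdeal R ↔ (2 : R) ∣ x := fun {x} ↦
    mem_maximalIdeal_iff_dvd_of_irreducible h2 x
  have hmn : ∀ {x : R} {n : ℕ}, x ∈ maximalIdeal R ^ n ↔ (2 : R) ^ n ∣ x := fun {x n} ↦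
    mem_maximalIdeal_pow_iff_dvd_of_irreducible h2 x n
  have hex2 := exists_variableChange_step2_of_perfectField V hΔm
  have hN2 : normalizeStep2 V = hex2.choose • V := dif_pos hex2
  obtain ⟨hu, hA₃, hA₄, hA₆⟩ := hex2.choose_spec
  rw [hN2] at hb₂ ha₆
  set N := hex2.choose • V with hN
  have ha₁ : (2 : R) ∣ N.a₁ := two_dvd_a₁_of_two_dvd_b₂ h2 N (hm.mp hb₂)
  have hΔ : V.Δ = N.Δ := (Δ_smul_of_u_eq_one hu V).symm
  rw [hΔ]
  exact addVal_Δ_toNat_eq_of_step3 h2 N ha₁ (hm.mp hA₃) (hm.mp hA₄) (hm.mp hA₆)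
    (fun h ↦ ha₆ (hmn.mpr h))

/-- **Type `III` when `2` is a uniformiser: `ord Δ ∈ {4, 6, 8, 9}`.**  The model of
`exists_smul_of_kodairaSymbolOfMinimal_eq_III` (`2 ∣ a₁, a₂, a₃`, `a₄ = 2·unit`, `4 ∣ a₆`, so that
`b₈ = 4(-q² + 2·…)` is not divisible by `8`) and `CharTwo.addVal_Δ_toNat_eq_of_step4`.  Silverman,
*ATAEC* IV.9.4 Step 4 with `π = 2`. [cite: SilvermanATAEC1994, IV.9.4 Step 4 and Table 4.1] -/
theorem addVal_Δ_toNat_eq_of_kodairaSymbolOfMinimal_eq_III_of_two [PerfectField (ResidueField R)]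
    (h2 : Irreducible (2 : R)) (V : WeierstrassCurve R) (hV : V.kodairaSymbolOfMinimal = .III) :
    (addVal R V.Δ).toNat = 4 ∨ (addVal R V.Δ).toNat = 6 ∨ (addVal R V.Δ).toNat = 8 ∨
      (addVal R V.Δ).toNat = 9 := by
  obtain ⟨D, h₁, h₂, h₃, h₄, h₄', h₆⟩ := exists_smul_of_kodairaSymbolOfMinimal_eq_III V hV
  have hm : ∀ {x : R}, x ∈ maximalIdeal R ↔ (2 : R) ∣ x := fun {x} ↦
    mem_maximalIdeal_iff_dvd_of_irreducible h2 x
  have hmn : ∀ {x : R} {n : ℕ}, x ∈ maximalIdeal R ^ n ↔ (2 : R) ^ n ∣ x := fun {x n} ↦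
    mem_maximalIdeal_pow_iff_dvd_of_irreducible h2 x n
  set N := D • V with hN
  obtain ⟨α, hα⟩ := hm.mp h₁
  obtain ⟨p, hp⟩ := hm.mp h₂
  obtain ⟨γ, hγ⟩ := hm.mp h₃
  obtain ⟨q, hq⟩ := hm.mp h₄
  obtain ⟨r₁, hr₁⟩ := hmn.mp h₆
  have hqu : IsUnit q := by
    rw [isUnit_iff_not_dvd h2]
    rintro ⟨q', hq'⟩
    exact h₄' (hmn.mpr ⟨q', by rw [hq, hq']; ring⟩)
  have h8 : ¬ (2 : R) ^ 3 ∣ N.b₈ := by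
    rintro ⟨w, hw⟩
    have hb₈ : N.b₈ = 2 ^ 2 * (-q ^ 2 +
        2 * (2 * α ^ 2 * r₁ + 4 * p * r₁ - α * γ * q + p * γ ^ 2)) := by
      simp only [WeierstrassCurve.b₈, hα, hp, hγ, hq, hr₁]; ring
    have hq2 : (2 : R) ∣ q ^ 2 := ⟨-(w - (2 * α ^ 2 * r₁ + 4 * p * r₁ - α * γ * q + p * γ ^ 2)), by
      have e : (2 : R) ^ 2 * (-q ^ 2 + 2 * (2 * α ^ 2 * r₁ + 4 * p * r₁ - α * γ * q + p * γ ^ 2))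
          = 2 ^ 3 * w := by rw [← hb₈, hw]
      have h4 : (2 : R) ^ 2 ≠ 0 := pow_ne_zero _ h2.ne_zero
      have e' : -q ^ 2 + 2 * (2 * α ^ 2 * r₁ + 4 * p * r₁ - α * γ * q + p * γ ^ 2) = 2 * w := by
        apply mul_left_cancel₀ h4
        linear_combination e
      linear_combination -e'⟩
    exact (isUnit_iff_not_dvd h2 _).mp hqu (h2.prime.dvd_of_dvd_pow hq2)
  rw [← addVal_Δ_smul_toNat D V]
  exact addVal_Δ_toNat_eq_of_step4 h2 N ⟨α, hα⟩ ⟨γ, hγ⟩ ⟨q, hq⟩ (hmn.mp h₆) h8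

/-- **Type `I₀*` when `2` is a uniformiser: `ord Δ ∈ {8, 9, 10}`.**  The Step-6 model of
`exists_smul_of_kodairaSymbolOfMinimal_eq_Istar_zero` (three distinct roots, i.e. `pq + r ∈ Rˣ`,
`CharTwo.isUnit_of_distinctRootCount_cubicStep6_eq_three`) and `CharTwo.addVal_Δ_toNat_eq_of_step6`.
Silverman, *ATAEC* IV.9.4 Step 6 with `π = 2`. [cite: SilvermanATAEC1994, IV.9.4 Step 6 and Table 4.1] -/
theorem addVal_Δ_toNat_eq_of_kodairaSymbolOfMinimal_eq_Istar_zero_of_two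
    [PerfectField (ResidueField R)] (h2 : Irreducible (2 : R)) (V : WeierstrassCurve R)
    (hΔ0 : V.Δ ≠ 0) (hV : V.kodairaSymbolOfMinimal = .Istar 0) :
    (addVal R V.Δ).toNat = 8 ∨ (addVal R V.Δ).toNat = 9 ∨ (addVal R V.Δ).toNat = 10 := by
  obtain ⟨D, h₁, h₂, h₃, h₄, h₆, h3⟩ := exists_smul_of_kodairaSymbolOfMinimal_eq_Istar_zero V hΔ0 hV
  have hm : ∀ {x : R}, x ∈ maximalIdeal R ↔ (2 : R) ∣ x := fun {x} ↦
    mem_maximalIdeal_iff_dvd_of_irreducible h2 x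
  have hmn : ∀ {x : R} {n : ℕ}, x ∈ maximalIdeal R ^ n ↔ (2 : R) ^ n ∣ x := fun {x n} ↦
    mem_maximalIdeal_pow_iff_dvd_of_irreducible h2 x n
  obtain ⟨α, hα⟩ := hm.mp h₁
  obtain ⟨p, hp⟩ := hm.mp h₂
  obtain ⟨γ, hγ⟩ := hmn.mp h₃
  obtain ⟨q, hq⟩ := hmn.mp h₄
  obtain ⟨r, hr⟩ := hmn.mp h₆
  have hI := isUnit_of_distinctRootCount_cubicStep6_eq_three h2 hp hq hr h3
  rw [← addVal_Δ_smul_toNat D V]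
  exact addVal_Δ_toNat_eq_of_step6 h2 (D • V) hα hp hγ hq hr hI

/-- **Type `III*` when `2` is a uniformiser: `ord Δ ∈ {10, 12, 14, 15}`.**  The Step-9 model of
`exists_smul_of_kodairaSymbolOfMinimal_eq_IIIstar` and `CharTwo.addVal_Δ_toNat_eq_of_step9`.
Silverman, *ATAEC* IV.9.4 Step 9 with `π = 2`. [cite: SilvermanATAEC1994, IV.9.4 Step 9 and Table 4.1] -/
theorem addVal_Δ_toNat_eq_of_kodairaSymbolOfMinimal_eq_IIIstar_of_two [PerfectField (ResidueField R)]
    (h2 : Irreducible (2 : R)) (V : WeierstrassCurve R) (hV : V.kodairaSymbolOfMinimal = .IIIstar) :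
    (addVal R V.Δ).toNat = 10 ∨ (addVal R V.Δ).toNat = 12 ∨ (addVal R V.Δ).toNat = 14 ∨
      (addVal R V.Δ).toNat = 15 := by
  obtain ⟨D, h₁, h₂, h₃, h₄, h₄', h₆⟩ := exists_smul_of_kodairaSymbolOfMinimal_eq_IIIstar V hV
  have hm : ∀ {x : R}, x ∈ maximalIdeal R ↔ (2 : R) ∣ x := fun {x} ↦
    mem_maximalIdeal_iff_dvd_of_irreducible h2 x
  have hmn : ∀ {x : R} {n : ℕ}, x ∈ maximalIdeal R ^ n ↔ (2 : R) ^ n ∣ x := fun {x n} ↦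
    mem_maximalIdeal_pow_iff_dvd_of_irreducible h2 x n
  rw [← addVal_Δ_smul_toNat D V]
  exact addVal_Δ_toNat_eq_of_step9 h2 (D • V) (hm.mp h₁) (hmn.mp h₂) (hmn.mp h₃) (hmn.mp h₄)
    (hmn.mp h₆) (fun h ↦ h₄' (hmn.mpr h))

/-- **Type `II*` when `2` is a uniformiser: `ord Δ ∈ {11, 12, 14}`.**  The Step-10 model of
`exists_smul_of_kodairaSymbolOfMinimal_eq_IIstar` and `CharTwo.addVal_Δ_toNat_eq_of_step10`.
Silverman, *ATAEC* IV.9.4 Step 10 with `π = 2`. [cite: SilvermanATAEC1994, IV.9.4 Step 10 and Table 4.1] -/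
theorem addVal_Δ_toNat_eq_of_kodairaSymbolOfMinimal_eq_IIstar_of_two [PerfectField (ResidueField R)]
    (h2 : Irreducible (2 : R)) (V : WeierstrassCurve R) (hV : V.kodairaSymbolOfMinimal = .IIstar) :
    (addVal R V.Δ).toNat = 11 ∨ (addVal R V.Δ).toNat = 12 ∨ (addVal R V.Δ).toNat = 14 := by
  obtain ⟨D, h₁, h₂, h₃, h₄, h₆, h₆'⟩ := exists_smul_of_kodairaSymbolOfMinimal_eq_IIstar V hV
  have hm : ∀ {x : R}, x ∈ maximalIdeal R ↔ (2 : R) ∣ x := fun {x} ↦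
    mem_maximalIdeal_iff_dvd_of_irreducible h2 x
  have hmn : ∀ {x : R} {n : ℕ}, x ∈ maximalIdeal R ^ n ↔ (2 : R) ^ n ∣ x := fun {x n} ↦
    mem_maximalIdeal_pow_iff_dvd_of_irreducible h2 x n
  rw [← addVal_Δ_smul_toNat D V]
  exact addVal_Δ_toNat_eq_of_step10 h2 (D • V) (hm.mp h₁) (hmn.mp h₂) (hmn.mp h₃) (hmn.mp h₄)
    (hmn.mp h₆) (fun h ↦ h₆' (hmn.mpr h))

end LocalIndex

end Literature.NumberTheory.EllipticCurves

/-! ### §3. Over `ℚ` at the place above `2` -/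

namespace WeierstrassCurve

open scoped NumberField
open NumberField IsDedekindDomain Literature.NumberTheory.EllipticCurves
  Literature.NumberTheory.DiophantineGeometry Literature.NumberTheory.DiophantineGeometry.TateAlgorithm

variable (W : WeierstrassCurve ℚ)

/-- **Type `II` at `2` over `ℚ`: `ord₂ Δ_min ∈ {4, 6, 7}`** (`2` is a uniformiser of `O_v ≃ ℤ₂`,
`irreducible_two_adicCompletionIntegers`; `kodairaSymbolAt_def`).
[cite: SilvermanATAEC1994, IV.9.4 Step 3 and Table 4.1] -/
theorem ordMinimalDiscriminant_eq_of_kodairaSymbolAt_II_two [W.IsElliptic]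
    {v : HeightOneSpectrum (𝓞 ℚ)} (hv : (2 : 𝓞 ℚ) ∈ v.asIdeal) (hT : W.kodairaSymbolAt v = .II) :
    W.ordMinimalDiscriminant v = 4 ∨ W.ordMinimalDiscriminant v = 6 ∨
      W.ordMinimalDiscriminant v = 7 := by
  have h2irr := irreducible_two_adicCompletionIntegers v (Rat.valuation_two_of_two_mem hv)
  rw [kodairaSymbolAt_def] at hT
  exact LocalIndex.addVal_Δ_toNat_eq_of_kodairaSymbolOfMinimal_eq_II_of_two h2irr _ hT

/-- **Type `III` at `2` over `ℚ`: `ord₂ Δ_min ∈ {4, 6, 8, 9}`.**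
[cite: SilvermanATAEC1994, IV.9.4 Step 4 and Table 4.1] -/
theorem ordMinimalDiscriminant_eq_of_kodairaSymbolAt_III_two [W.IsElliptic]
    {v : HeightOneSpectrum (𝓞 ℚ)} (hv : (2 : 𝓞 ℚ) ∈ v.asIdeal) (hT : W.kodairaSymbolAt v = .III) :
    W.ordMinimalDiscriminant v = 4 ∨ W.ordMinimalDiscriminant v = 6 ∨
      W.ordMinimalDiscriminant v = 8 ∨ W.ordMinimalDiscriminant v = 9 := by
  have h2irr := irreducible_two_adicCompletionIntegers v (Rat.valuation_two_of_two_mem hv)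
  rw [kodairaSymbolAt_def] at hT
  exact LocalIndex.addVal_Δ_toNat_eq_of_kodairaSymbolOfMinimal_eq_III_of_two h2irr _ hT

/-- **Type `I₀*` at `2` over `ℚ`: `ord₂ Δ_min ∈ {8, 9, 10}`.**
[cite: SilvermanATAEC1994, IV.9.4 Step 6 and Table 4.1] -/
theorem ordMinimalDiscriminant_eq_of_kodairaSymbolAt_Istar_zero_two [W.IsElliptic]
    {v : HeightOneSpectrum (𝓞 ℚ)} (hv : (2 : 𝓞 ℚ) ∈ v.asIdeal)
    (hT : W.kodairaSymbolAt v = .Istar 0) :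
    W.ordMinimalDiscriminant v = 8 ∨ W.ordMinimalDiscriminant v = 9 ∨
      W.ordMinimalDiscriminant v = 10 := by
  have h2irr := irreducible_two_adicCompletionIntegers v (Rat.valuation_two_of_two_mem hv)
  rw [kodairaSymbolAt_def] at hT
  exact LocalIndex.addVal_Δ_toNat_eq_of_kodairaSymbolOfMinimal_eq_Istar_zero_of_two h2irr _
    (localMinimalIntegralModel_Δ_ne_zero v W) hT

/-- **Type `III*` at `2` over `ℚ`: `ord₂ Δ_min ∈ {10, 12, 14, 15}`.**
[cite: SilvermanATAEC1994, IV.9.4 Step 9 and Table 4.1] -/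
theorem ordMinimalDiscriminant_eq_of_kodairaSymbolAt_IIIstar_two [W.IsElliptic]
    {v : HeightOneSpectrum (𝓞 ℚ)} (hv : (2 : 𝓞 ℚ) ∈ v.asIdeal)
    (hT : W.kodairaSymbolAt v = .IIIstar) :
    W.ordMinimalDiscriminant v = 10 ∨ W.ordMinimalDiscriminant v = 12 ∨
      W.ordMinimalDiscriminant v = 14 ∨ W.ordMinimalDiscriminant v = 15 := by
  have h2irr := irreducible_two_adicCompletionIntegers v (Rat.valuation_two_of_two_mem hv)
  rw [kodairaSymbolAt_def] at hT
  exact LocalIndex.addVal_Δ_toNat_eq_of_kodairaSymbolOfMinimal_eq_IIIstar_of_two h2irr _ hT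

/-- **Type `II*` at `2` over `ℚ`: `ord₂ Δ_min ∈ {11, 12, 14}`.**
[cite: SilvermanATAEC1994, IV.9.4 Step 10 and Table 4.1] -/
theorem ordMinimalDiscriminant_eq_of_kodairaSymbolAt_IIstar_two [W.IsElliptic]
    {v : HeightOneSpectrum (𝓞 ℚ)} (hv : (2 : 𝓞 ℚ) ∈ v.asIdeal)
    (hT : W.kodairaSymbolAt v = .IIstar) :
    W.ordMinimalDiscriminant v = 11 ∨ W.ordMinimalDiscriminant v = 12 ∨
      W.ordMinimalDiscriminant v = 14 := by
  have h2irr := irreducible_two_adicCompletionIntegers v (Rat.valuation_two_of_two_mem hv)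
  rw [kodairaSymbolAt_def] at hT
  exact LocalIndex.addVal_Δ_toNat_eq_of_kodairaSymbolOfMinimal_eq_IIstar_of_two h2irr _ hT

/-- **The wild exponent `δ₂` on each branch** (`δ_v = f_v - 2 = ord_v Δ_min - (m_v + 1)` for the
additive types, by the tree's definition of the conductor exponent through Ogg's formula): over `ℚ`
at `2`, type `II` has `δ₂ ∈ {2, 4, 5}`, type `III` has `δ₂ ∈ {1, 3, 5, 6}`, type `I₀*` has
`δ₂ ∈ {2, 3, 4}`, type `III*` has `δ₂ ∈ {1, 3, 5, 6}`, type `II*` has `δ₂ ∈ {1, 2, 4}` — stated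
here for `II` and `II*` through `wildConductorExponent_eq_of_kodairaSymbolAt_wild`.  Silverman,
*ATAEC* Table 4.1 with IV.11.1 (over `ℚ₂`: `f = 4, 6, 7` for type `II`; `f = 3, 4, 6` for `II*`).
[cite: SilvermanATAEC1994, IV.9 Table 4.1 and Thm. IV.11.1] -/
theorem wildConductorExponent_eq_of_kodairaSymbolAt_II_two [W.IsElliptic]
    {v : HeightOneSpectrum (𝓞 ℚ)} (hv : (2 : 𝓞 ℚ) ∈ v.asIdeal) (hT : W.kodairaSymbolAt v = .II) :
    W.wildConductorExponent v = 2 ∨ W.wildConductorExponent v = 4 ∨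
      W.wildConductorExponent v = 5 := by
  rw [W.wildConductorExponent_eq_of_kodairaSymbolAt_wild v (Or.inl ⟨hT, rfl⟩)]
  rcases W.ordMinimalDiscriminant_eq_of_kodairaSymbolAt_II_two hv hT with h | h | h <;>
    rw [h] <;> norm_num

/-- `δ₂ ∈ {1, 2, 4}` for type `II*` at `2` over `ℚ`. [cite: SilvermanATAEC1994, IV.9 Table 4.1 and Thm. IV.11.1] -/
theorem wildConductorExponent_eq_of_kodairaSymbolAt_IIstar_two [W.IsElliptic]
    {v : HeightOneSpectrum (𝓞 ℚ)} (hv : (2 : 𝓞 ℚ) ∈ v.asIdeal) (hT : W.kodairaSymbolAt v = .IIstar) :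
    W.wildConductorExponent v = 1 ∨ W.wildConductorExponent v = 2 ∨
      W.wildConductorExponent v = 4 := by
  rw [W.wildConductorExponent_eq_of_kodairaSymbolAt_wild v (Or.inr (Or.inr (Or.inr ⟨hT, rfl⟩)))]
  rcases W.ordMinimalDiscriminant_eq_of_kodairaSymbolAt_IIstar_two hv hT with h | h | h <;>
    rw [h] <;> norm_num

end WeierstrassCurve
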